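import Literature.IUT.HodgeTheaters.PiAvatarToFlStar
import HarnessLib

/-!
# The SURJECTIVITY clause of [IUTchI] Def 6.1 (v) for the kit slot `toFlStar : Aut(𝒟^{⊚±}) ↠ 𝔽_l^⋇` at the genuine
# initial Θ-data: reduction to the Π-level SPLIT-TORUS SENTENCE (KIT-INSTANCE-SPEC P5-binding / D13-P3-v; proof-only —
# post-freeze additive D13, not a cone member)

S. Mochizuki, *Inter-universal Teichmüller theory I*, kurims manuscript (May 2020), §6 Definition 6.1 (v) p. 158
l. 14–23: "the image of the above outer homomorphism [`Aut(𝒟^{⊚±}) → GL₂(𝔽_l)/{±1}`] is equal to a subgroup of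
`GL₂(𝔽_l)/{±1}` that contains a Borel subgroup of `SL₂(𝔽_l)/{±1}` … — i.e., the Borel subgroup corresponding to the
rank one quotient of `Δ_X^{ab} ⊗ 𝔽_l` that gives rise to the covering `X̲_K → X_K`. In particular, this rank one
quotient determines a natural surjective homomorphism `Aut(𝒟^{⊚±}) ↠ 𝔽_l^⋇`" ([IUTchI] Def 6.1 (v) p.158)
[claim: Mochizuki2012, status: disputed] (D-0012 claim key, series status DISPUTED — this file is FINITE GROUP THEORY
over abc-iut-L5-t2's REAL `InitialThetaData` in the Π-avatar (design D1 EMBEDDED); nothing of the series is asserted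
and no side is taken on [IUTchIII] Cor. 3.12).

## What is proved (node IUTchI:Def6.1(v); kit axiom `PMBaseKit.toFlStar_surjective` at `G := gModel`)

abc-iut-L5-t4's `InitialThetaData.toFlStarGlobal : Aut(𝒟^{⊚±}) →* 𝔽_l^⋇` (`PiAvatarToFlStar`, p425994) is
`OrbitCat.autEquiv`⁻¹ followed by abc-iut-w4-d065's character `toFlStarOfNormalizer Π_{X̲_K} Π_{X_K}` descended modulo
`Π_{X̲_K}`; its SURJECTIVITY (the printed clause quoted above) was left open there. Here, with `Y := Π_{X̲_K} = D.PiXund`,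
`X := Π_{X_K} = D.PiXK`, `A := Π_{C_F} = D.PiC`:

* `normalizerIncl_bijective` — `N_A(Y) = N_A(X) ⊓ N_A(Y)` (t4's `normalizer_PiXund_le_normalizer_PiXK`), so d065's
  criterion, stated on the joint normaliser, applies verbatim on `N_A(Y) = Aut`-representatives;
* `toFlStarGlobal_surjective_iff_onNormalizer` — surjectivity is insensitive to `autEquiv` and to the descent
  modulo `Y` (`QuotientGroup.mk` is onto);
* **`toFlStarGlobal_surjective_iff`** — `Aut(𝒟^{⊚±}) → 𝔽_l^⋇` is onto **iff** every unit `u ∈ 𝔽_l^×` is, UP TO SIGN,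
  the exponent `conjExponent n` of some `n ∈ N_A(Π_{X̲_K})` on the rank-one quotient `Π_{X_K}/Π_{X̲_K} ≅ ℤ/l`;
* **`toFlStarGlobal_surjective_iff_forall_exists_conj`** — the same with the exponent condition in ELEMENTARY
  membership form `∀ k ∈ Π_{X_K}, (k^u)⁻¹ · n k n⁻¹ ∈ Π_{X̲_K}` (no reference to d065's `conjExponent`);
* **`toFlStarGlobal_surjective_of_forall_exists_conj`** — the printed mechanism: if for EVERY unit `u` some
  `n ∈ N_A(Π_{X̲_K})` acts on `Π_{X_K}/Π_{X̲_K}` by `k ↦ k^u` (the split torus `{diag(u⁻¹, u)}` of the Borel subgroup of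
  `SL₂(𝔽_l)` stabilising the rank-one quotient, supplied in print by Def 3.1 (c) "`Gal(K/F) ⊇ SL₂(𝔽_l)`" and the
  construction of `X̲_K`), then `toFlStarGlobal` is surjective; `toFlStarGlobal_surjective_of_exists_generator` — ONE
  element acting by a generator of `𝔽_l^×` already suffices; and `index_ker_toFlStarGlobal_of_surjective` — then
  `[Aut(𝒟^{⊚±}) : Aut_±(𝒟^{⊚±})] = l⋇ = (l − 1)/2` (abc-iut-L5-t3's `card_flStar`).

HONEST READING (recorded as a GAP-LEDGER row by this seat): the hypothesis of `…_of_forall_exists_conj` is NOT derivable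
from `InitialThetaData` as typed — the interface `ThetaGeometry`/`PuncturedEllipticData` carries no comparison between
the conjugation action of `Π_{C_F}` on `Π_{X_K}/Π_{X̲_K}` and the point-level Galois image `ImageContainsSL2` of
Def 3.1 (c), nor the identification of `Π_{X̲_K}` with the subgroup cut out by a rank-one quotient of `Δ_X^{ab} ⊗ 𝔽_l`;
it is therefore an INSTANCE LAW of the genuine kit (to be carried as a named binder, never as a `Prop` fact).
Proof-only (0 definitions, no instance, no notation); Mathlib + `PiAvatarToFlStar`. typed ≠ proved elsewhere.
-/

namespace Literature.IUT.HodgeTheaters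

open CategoryTheory

universe u v w

section Surjective

variable {F : Type u} {K : Type v} {Fbar : Type w} [Field F] [NumberField F] [Field K] [NumberField K]
  [Algebra F K] [Field Fbar] [Algebra F Fbar] [Algebra K Fbar]
  {E : WeierstrassCurve F} [E.IsElliptic] {l : ℕ} {Pb : BadPlacePredicates K}
  (D : InitialThetaData F K Fbar E l Pb)

namespace InitialThetaData

/-! ### `N_A(Π_{X̲_K}) = N_A(Π_{X_K}) ⊓ N_A(Π_{X̲_K})` -/

/-- t4's inclusion `N_A(Π_{X̲_K}) ↪ N_A(Π_{X_K}) ⊓ N_A(Π_{X̲_K})` is a BIJECTION (`N_A(Π_{X̲_K}) ≤ N_A(Π_{X_K})`,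
`normalizer_PiXund_le_normalizer_PiXK`): every element of the joint normaliser — the domain of d065's character — is an
`Aut(𝒟^{⊚±})`-representative. ([IUTchI] Def 6.1 (v) p.158) [claim: Mochizuki2012, status: disputed] -/
theorem normalizerIncl_bijective : Function.Bijective D.normalizerIncl := by
  refine ⟨fun n m h => Subtype.ext (by simpa using congrArg Subtype.val h), fun m => ?_⟩
  exact ⟨⟨(m : D.PiC), m.2.2⟩, Subtype.ext rfl⟩

/-! ### Surjectivity is decided on normaliser representatives -/

variable [Fact l.Prime] [hN : (D.PiXund.subgroupOf D.PiXK).Normal]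

/-- `Aut(𝒟^{⊚±}) → 𝔽_l^⋇` is surjective iff d065's character is surjective on `N_A(Π_{X̲_K})`: `OrbitCat.autEquiv` is a
bijection and the descent modulo `Π_{X̲_K}` is along the surjection `QuotientGroup.mk`.
([IUTchI] Def 6.1 (v) p.158) [claim: Mochizuki2012, status: disputed] -/
theorem toFlStarGlobal_surjective_iff_onNormalizer :
    Function.Surjective D.toFlStarGlobal ↔ Function.Surjective D.toFlStarOnNormalizer := by
  have h1 : (D.toFlStarGlobal : Aut D.gModelObj → FlStar l) =
      (QuotientGroup.lift _ D.toFlStarOnNormalizer D.subgroupOf_le_ker_toFlStarOnNormalizer) ∘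
        (OrbitCat.autEquiv D.PiXund).symm := rfl
  have h2 : (D.toFlStarOnNormalizer :
      ↥(Subgroup.normalizer ((D.PiXund : Subgroup D.PiC) : Set D.PiC)) → FlStar l) =
      (QuotientGroup.lift _ D.toFlStarOnNormalizer D.subgroupOf_le_ker_toFlStarOnNormalizer) ∘
        (QuotientGroup.mk : _ → _ ⧸ D.PiXund.subgroupOf (Subgroup.normalizer ((D.PiXund : Subgroup D.PiC) : Set D.PiC))) := by
    funext n
    exact (QuotientGroup.lift_mk _ D.subgroupOf_le_ker_toFlStarOnNormalizer n).symm
  rw [h1, Function.Surjective.of_comp_iff _ (OrbitCat.autEquiv D.PiXund).symm.surjective, h2,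
    Function.Surjective.of_comp_iff _ QuotientGroup.mk_surjective]

/-- … iff d065's character `toFlStarOfNormalizer Π_{X̲_K} Π_{X_K}` on the joint normaliser is surjective
(`normalizerIncl_bijective`). ([IUTchI] Def 6.1 (v) p.158) [claim: Mochizuki2012, status: disputed] -/
theorem toFlStarGlobal_surjective_iff_ofNormalizer :
    Function.Surjective D.toFlStarGlobal ↔
      Function.Surjective (toFlStarOfNormalizer D.PiXund D.PiXK D.PiXund_le_PiXK D.PiXund_relIndex_PiXK) := by
  rw [toFlStarGlobal_surjective_iff_onNormalizer]
  show Function.Surjective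
      ((toFlStarOfNormalizer D.PiXund D.PiXK D.PiXund_le_PiXK D.PiXund_relIndex_PiXK) ∘ D.normalizerIncl) ↔ _
  exact Function.Surjective.of_comp_iff _ D.normalizerIncl_bijective.surjective

/-- **[IUTchI] Def 6.1 (v) surjectivity ⟺ the split-torus sentence, exponent form.** `Aut(𝒟^{⊚±}) → 𝔽_l^⋇` is surjective
iff every unit `u ∈ 𝔽_l^×` is, UP TO SIGN, the exponent of the conjugation action of some `n ∈ N_{Π_{C_F}}(Π_{X̲_K})` on the
rank-one quotient `Π_{X_K}/Π_{X̲_K} ≅ ℤ/l` (print: the image "contains a Borel subgroup of `SL₂(𝔽_l)/{±1}`", whose split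
torus acts on the rank-one quotient by every unit). ([IUTchI] Def 6.1 (v) p.158) [claim: Mochizuki2012, status: disputed] -/
theorem toFlStarGlobal_surjective_iff :
    Function.Surjective D.toFlStarGlobal ↔
      ∀ u : (ZMod l)ˣ, ∃ n : ↥(Subgroup.normalizer ((D.PiXund : Subgroup D.PiC) : Set D.PiC)),
        conjExponent D.PiXund D.PiXK D.PiXund_le_PiXK D.PiXund_relIndex_PiXK (D.normalizerIncl n) = u ∨
        conjExponent D.PiXund D.PiXK D.PiXund_le_PiXK D.PiXund_relIndex_PiXK (D.normalizerIncl n) = -u := by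
  rw [toFlStarGlobal_surjective_iff_ofNormalizer, toFlStarOfNormalizer_surjective_iff]
  refine forall_congr' fun u => ⟨?_, ?_⟩
  · rintro ⟨m, hm⟩
    obtain ⟨n, rfl⟩ := D.normalizerIncl_bijective.surjective m
    exact ⟨n, hm⟩
  · rintro ⟨n, hn⟩
    exact ⟨D.normalizerIncl n, hn⟩

/-- **[IUTchI] Def 6.1 (v) surjectivity ⟺ the split-torus sentence, elementary form** (no reference to d065's
`conjExponent`): `Aut(𝒟^{⊚±}) → 𝔽_l^⋇` is surjective iff for every unit `u` there is `n ∈ N_{Π_{C_F}}(Π_{X̲_K})` with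
`n k n⁻¹ ≡ k^{u} (mod Π_{X̲_K})` for all `k ∈ Π_{X_K}`, or with `n k n⁻¹ ≡ k^{−u}` for all `k ∈ Π_{X_K}`.
([IUTchI] Def 6.1 (v) p.158) [claim: Mochizuki2012, status: disputed] -/
theorem toFlStarGlobal_surjective_iff_forall_exists_conj :
    Function.Surjective D.toFlStarGlobal ↔
      ∀ u : (ZMod l)ˣ, ∃ n : D.PiC, n ∈ Subgroup.normalizer ((D.PiXund : Subgroup D.PiC) : Set D.PiC) ∧
        ((∀ k ∈ D.PiXK, (k ^ (u : ZMod l).val)⁻¹ * (n * k * n⁻¹) ∈ D.PiXund) ∨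
          (∀ k ∈ D.PiXK, (k ^ ((-u : (ZMod l)ˣ) : ZMod l).val)⁻¹ * (n * k * n⁻¹) ∈ D.PiXund)) := by
  rw [toFlStarGlobal_surjective_iff]
  refine forall_congr' fun u => ⟨?_, ?_⟩
  · rintro ⟨n, hn⟩
    refine ⟨(n : D.PiC), n.2, ?_⟩
    rcases hn with hn | hn
    · exact Or.inl ((conjExponent_eq_iff D.PiXund_le_PiXK D.PiXund_relIndex_PiXK _ u).mp hn)
    · exact Or.inr ((conjExponent_eq_iff D.PiXund_le_PiXK D.PiXund_relIndex_PiXK _ (-u)).mp hn)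
  · rintro ⟨n, hn, h⟩
    refine ⟨⟨n, hn⟩, ?_⟩
    rcases h with h | h
    · exact Or.inl ((conjExponent_eq_iff D.PiXund_le_PiXK D.PiXund_relIndex_PiXK _ u).mpr h)
    · exact Or.inr ((conjExponent_eq_iff D.PiXund_le_PiXK D.PiXund_relIndex_PiXK _ (-u)).mpr h)

/-- **The printed mechanism, as an implication** (the binder shape for the P5-binding's `toFlStar_surjective` and for the
layer-5 certificate): if for EVERY unit `u ∈ 𝔽_l^×` some element of `N_{Π_{C_F}}(Π_{X̲_K})` acts on `Π_{X_K}/Π_{X̲_K}` by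
`k ↦ k^u` — in print, the split torus of "a Borel subgroup of `SL₂(𝔽_l)`" stabilising the rank-one quotient, available
because `Gal(K/F) ⊇ SL₂(𝔽_l)` (Def 3.1 (c)) and `X̲_K → X_K` is "determined by the rank one quotient" (Def 3.1 (d)) —
then `toFlStar : Aut(𝒟^{⊚±}) → 𝔽_l^⋇` is SURJECTIVE. The hypothesis is an arithmetic input NOT derivable from
`InitialThetaData` as typed (module docstring). ([IUTchI] Def 6.1 (v) p.158) [claim: Mochizuki2012, status: disputed] -/
theorem toFlStarGlobal_surjective_of_forall_exists_conj
    (hT : ∀ u : (ZMod l)ˣ, ∃ n : D.PiC, n ∈ Subgroup.normalizer ((D.PiXund : Subgroup D.PiC) : Set D.PiC) ∧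
      ∀ k ∈ D.PiXK, (k ^ (u : ZMod l).val)⁻¹ * (n * k * n⁻¹) ∈ D.PiXund) :
    Function.Surjective D.toFlStarGlobal := by
  rw [toFlStarGlobal_surjective_iff_forall_exists_conj]
  intro u
  obtain ⟨n, hn, h⟩ := hT u
  exact ⟨n, hn, Or.inl h⟩

/-- **One primitive automorphism suffices**: if a SINGLE `n ∈ N_{Π_{C_F}}(Π_{X̲_K})` acts on `Π_{X_K}/Π_{X̲_K}` by `k ↦ k^g`
with `g` a generator of the cyclic group `𝔽_l^×` (a generator of the split torus), then `toFlStar : Aut(𝒟^{⊚±}) → 𝔽_l^⋇` is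
surjective (its powers realise every unit). ([IUTchI] Def 6.1 (v) p.158) [claim: Mochizuki2012, status: disputed] -/
theorem toFlStarGlobal_surjective_of_exists_generator (g : (ZMod l)ˣ) (hg : ∀ u : (ZMod l)ˣ, u ∈ Subgroup.zpowers g)
    (hn : ∃ n : D.PiC, n ∈ Subgroup.normalizer ((D.PiXund : Subgroup D.PiC) : Set D.PiC) ∧
      ∀ k ∈ D.PiXK, (k ^ (g : ZMod l).val)⁻¹ * (n * k * n⁻¹) ∈ D.PiXund) :
    Function.Surjective D.toFlStarGlobal := by
  rw [toFlStarGlobal_surjective_iff]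
  obtain ⟨n, hnN, hng⟩ := hn
  have hχ : conjExponent D.PiXund D.PiXK D.PiXund_le_PiXK D.PiXund_relIndex_PiXK (D.normalizerIncl ⟨n, hnN⟩) = g :=
    (conjExponent_eq_iff D.PiXund_le_PiXK D.PiXund_relIndex_PiXK _ g).mpr hng
  intro u
  obtain ⟨k, rfl⟩ := Subgroup.mem_zpowers_iff.mp (hg u)
  exact ⟨⟨n, hnN⟩ ^ k, Or.inl (by rw [map_zpow, map_zpow, hχ])⟩

/-- Under surjectivity, **`[Aut(𝒟^{⊚±}) : Aut_±(𝒟^{⊚±})] = l⋇ = (l − 1)/2`** (`Aut_± = Ker(Aut ↠ 𝔽_l^⋇)`, [IUTchI] §4 p.95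
"`𝔽_l^⋇` … of cardinality `l⋇`"), for the odd prime `l` (Def 3.1 (c): `l ≥ 5`).
([IUTchI] Def 6.1 (v) p.158) [claim: Mochizuki2012, status: disputed] -/
theorem index_ker_toFlStarGlobal_of_surjective (hl : l ≠ 2) (hs : Function.Surjective D.toFlStarGlobal) :
    (D.toFlStarGlobal).ker.index = lStar l := by
  rw [Subgroup.index_ker, MonoidHom.range_eq_top.mpr hs, Subgroup.card_top, card_flStar l hl]

end InitialThetaData

end Surjective

end Literature.IUT.HodgeTheaters
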